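import Mathlib
import Literature.NumberTheory.Irrationality.BrownZudilin2022.GeneralFamily
import Literature.NumberTheory.Irrationality.BrownZudilin2022.BarnesRepresentation

/-!
# UNIFORM kernel certificates for ALL corner classes of gen-1's dictionary — part C: families `Z7` (cell `pub-zeta5`, lineage gen-1, g20)

HONEST FRAMING: systematic search; no irrationality claim unless certified.  STRUCTURE only: five identities among products of
Γ-functions (the integrand `barnesKernel` of Brown–Zudilin's Barnes representation (16), arXiv:2210.03391, as DEFINED in
`BarnesRepresentation.lean`); nothing is evaluated; nothing about linear forms or ζ(5).

See part A (`WedgeDictionaryKernelUniformA.lean`) for the full description: the (H1)-free KERNEL ROUTE, the five families, the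
provenance of the certificates and what is NOT asserted.  Split for the 400-line limit into `WedgeDictionaryKernelUniformA.lean` (families `T11`, `G7`), `…UniformB.lean` (`E6`, `P11`)
and `…UniformC.lean` (`Z7`); the five family blocks are g20's farm-checked text verbatim (gen-1 g21 re-staging, per-term docstrings added).
-/

set_option maxHeartbeats 8000000
set_option linter.unusedSimpArgs false
set_option linter.unusedTactic false
set_option linter.unreachableTactic false
set_option linter.style.longLine false
set_option linter.unusedVariables false

open Literature.NumberTheory.Irrationality.BrownZudilin2022

/-! ## Family `Z7` — domain: x = y = 0 (X = Y = h) -/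

namespace Summit.KontsevichZagierPeriods.Zeta5Search.WedgeDictionary.KernelUniform.Z7


/-- Right-hand term 0 of the `Z7` kernel certificate at its shifted argument, as an explicit Γ-product. -/
theorem term_0 (h : ℤ) (s t : ℂ) :
    barnesKernel ![0, 0, h, h, h, 0, 0] ![h, 0, 0, 0, h] s t =
      Complex.Gamma (s + 1) * Complex.Gamma (s + 1) * Complex.Gamma (s + (h : ℂ) + 1) * Complex.Gamma (-s) / (Complex.Gamma (s + (h : ℂ) + 2) * Complex.Gamma (s + (h : ℂ) + 2)) * (Complex.Gamma (t + (h : ℂ) + 1) * Complex.Gamma (t + 1) * Complex.Gamma (t + 1) * Complex.Gamma (-t) / (Complex.Gamma (t + (h : ℂ) + 2) * Complex.Gamma (t + (h : ℂ) + 2))) * (Complex.Gamma (s + t + (h : ℂ) + 2) * Complex.Gamma (-s - t - 1)) := by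
  simp [barnesKernel, -mul_eq_mul_left_iff, -mul_eq_mul_right_iff]
  all_goals (try push_cast)
  all_goals (try ring_nf)
  all_goals (try simp only [true_or, or_true])

/-- Right-hand term 1 of the `Z7` kernel certificate at its shifted argument, as an explicit Γ-product. -/
theorem term_1 (h : ℤ) (s t : ℂ) :
    barnesKernel ![0, 0, h - 1, h - 1, h - 1, 0, 1] ![h - 1, 0, 1, 1, h - 1] s t =
      Complex.Gamma (s + 1) * Complex.Gamma (s + 1) * Complex.Gamma (s + (h : ℂ)) * Complex.Gamma (-s) / (Complex.Gamma (s + (h : ℂ) + 1) * Complex.Gamma (s + (h : ℂ) + 1)) * (Complex.Gamma (t + (h : ℂ)) * Complex.Gamma (t + 1) * Complex.Gamma (t + 2) * Complex.Gamma (-t) / (Complex.Gamma (t + (h : ℂ) + 2) * Complex.Gamma (t + (h : ℂ) + 1))) * (Complex.Gamma (s + t + (h : ℂ) + 1) * Complex.Gamma (-s - t - 1)) := by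
  simp [barnesKernel, -mul_eq_mul_left_iff, -mul_eq_mul_right_iff]
  all_goals (try push_cast)
  all_goals (try ring_nf)
  all_goals (try simp only [true_or, or_true])

/-- Right-hand term 2 of the `Z7` kernel certificate at its shifted argument, as an explicit Γ-product. -/
theorem term_2 (h : ℤ) (s t : ℂ) :
    barnesKernel ![0, 0, h - 1, h, h - 1, 0, 1] ![h, 0, 1, 1, h] s t =
      Complex.Gamma (s + 1) * Complex.Gamma (s + 1) * Complex.Gamma (s + (h : ℂ)) * Complex.Gamma (-s) / (Complex.Gamma (s + (h : ℂ) + 2) * Complex.Gamma (s + (h : ℂ) + 1)) * (Complex.Gamma (t + (h : ℂ)) * Complex.Gamma (t + 1) * Complex.Gamma (t + 2) * Complex.Gamma (-t) / (Complex.Gamma (t + (h : ℂ) + 2) * Complex.Gamma (t + (h : ℂ) + 2))) * (Complex.Gamma (s + t + (h : ℂ) + 2) * Complex.Gamma (-s - t - 1)) := by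
  simp [barnesKernel, -mul_eq_mul_left_iff, -mul_eq_mul_right_iff]
  all_goals (try push_cast)
  all_goals (try ring_nf)
  all_goals (try simp only [true_or, or_true])

/-- Right-hand term 3 of the `Z7` kernel certificate at its shifted argument, as an explicit Γ-product. -/
theorem term_3 (h : ℤ) (s t : ℂ) :
    barnesKernel ![0, 0, h, h, h - 1, 0, 1] ![h, 0, 1, 1, h] s t =
      Complex.Gamma (s + 1) * Complex.Gamma (s + 1) * Complex.Gamma (s + (h : ℂ) + 1) * Complex.Gamma (-s) / (Complex.Gamma (s + (h : ℂ) + 2) * Complex.Gamma (s + (h : ℂ) + 2)) * (Complex.Gamma (t + (h : ℂ)) * Complex.Gamma (t + 1) * Complex.Gamma (t + 2) * Complex.Gamma (-t) / (Complex.Gamma (t + (h : ℂ) + 2) * Complex.Gamma (t + (h : ℂ) + 2))) * (Complex.Gamma (s + t + (h : ℂ) + 2) * Complex.Gamma (-s - t - 1)) := by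
  simp [barnesKernel, -mul_eq_mul_left_iff, -mul_eq_mul_right_iff]
  all_goals (try push_cast)
  all_goals (try ring_nf)
  all_goals (try simp only [true_or, or_true])

/-- Right-hand term 4 of the `Z7` kernel certificate at its shifted argument, as an explicit Γ-product. -/
theorem term_4 (h : ℤ) (s t : ℂ) :
    barnesKernel ![0, 1, h - 1, h - 1, h - 1, 0, 0] ![h - 2, 1, 0, 0, h - 1] s t =
      Complex.Gamma (s + 1) * Complex.Gamma (s + 2) * Complex.Gamma (s + (h : ℂ)) * Complex.Gamma (-s) / (Complex.Gamma (s + (h : ℂ) + 1) * Complex.Gamma (s + (h : ℂ) + 2)) * (Complex.Gamma (t + (h : ℂ)) * Complex.Gamma (t + 1) * Complex.Gamma (t + 1) * Complex.Gamma (-t) / (Complex.Gamma (t + (h : ℂ) + 1) * Complex.Gamma (t + (h : ℂ) + 1))) * (Complex.Gamma (s + t + (h : ℂ) + 1) * Complex.Gamma (-s - t - 1)) := by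
  simp [barnesKernel, -mul_eq_mul_left_iff, -mul_eq_mul_right_iff]
  all_goals (try push_cast)
  all_goals (try ring_nf)
  all_goals (try simp only [true_or, or_true])

/-- Right-hand term 5 of the `Z7` kernel certificate at its shifted argument, as an explicit Γ-product. -/
theorem term_5 (h : ℤ) (s t : ℂ) :
    barnesKernel ![0, 1, h - 1, h, h, 0, 0] ![h - 1, 1, 0, 0, h] s t =
      Complex.Gamma (s + 1) * Complex.Gamma (s + 2) * Complex.Gamma (s + (h : ℂ)) * Complex.Gamma (-s) / (Complex.Gamma (s + (h : ℂ) + 2) * Complex.Gamma (s + (h : ℂ) + 2)) * (Complex.Gamma (t + (h : ℂ) + 1) * Complex.Gamma (t + 1) * Complex.Gamma (t + 1) * Complex.Gamma (-t) / (Complex.Gamma (t + (h : ℂ) + 2) * Complex.Gamma (t + (h : ℂ) + 2))) * (Complex.Gamma (s + t + (h : ℂ) + 2) * Complex.Gamma (-s - t - 1)) := by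
  simp [barnesKernel, -mul_eq_mul_left_iff, -mul_eq_mul_right_iff]
  all_goals (try push_cast)
  all_goals (try ring_nf)
  all_goals (try simp only [true_or, or_true])

/-- Right-hand term 6 of the `Z7` kernel certificate at its shifted argument, as an explicit Γ-product. -/
theorem term_6 (h : ℤ) (s t : ℂ) :
    barnesKernel ![0, 1, h, h, h, 1, 1] ![h - 1, 0, 0, 1, h - 1] s (t - 1) =
      Complex.Gamma (s + 1) * Complex.Gamma (s + 2) * Complex.Gamma (s + (h : ℂ) + 1) * Complex.Gamma (-s) / (Complex.Gamma (s + (h : ℂ) + 2) * Complex.Gamma (s + (h : ℂ) + 2)) * (Complex.Gamma (t + (h : ℂ)) * Complex.Gamma (t + 1) * Complex.Gamma (t + 1) * Complex.Gamma (-t + 1) / (Complex.Gamma (t + (h : ℂ) + 2) * Complex.Gamma (t + (h : ℂ) + 1))) * (Complex.Gamma (s + t + (h : ℂ) + 1) * Complex.Gamma (-s - t - 1)) := by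
  simp [barnesKernel, -mul_eq_mul_left_iff, -mul_eq_mul_right_iff]
  all_goals (try push_cast)
  all_goals (try ring_nf)
  all_goals (try simp only [true_or, or_true])

/-- Right-hand term 7 of the `Z7` kernel certificate at its shifted argument, as an explicit Γ-product. -/
theorem term_7 (h : ℤ) (s t : ℂ) :
    barnesKernel ![1, 1, h, h + 1, h, 1, 1] ![h, 0, 0, 0, h] (s - 1) (t - 1) =
      Complex.Gamma (s + 1) * Complex.Gamma (s + 1) * Complex.Gamma (s + (h : ℂ)) * Complex.Gamma (-s + 1) / (Complex.Gamma (s + (h : ℂ) + 2) * Complex.Gamma (s + (h : ℂ) + 1)) * (Complex.Gamma (t + (h : ℂ)) * Complex.Gamma (t + 1) * Complex.Gamma (t + 1) * Complex.Gamma (-t + 1) / (Complex.Gamma (t + (h : ℂ) + 1) * Complex.Gamma (t + (h : ℂ) + 2))) * (Complex.Gamma (s + t + (h : ℂ) + 1) * Complex.Gamma (-s - t - 1)) := by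
  simp [barnesKernel, -mul_eq_mul_left_iff, -mul_eq_mul_right_iff]
  all_goals (try push_cast)
  all_goals (try ring_nf)
  all_goals (try simp only [true_or, or_true])

/-- UNIFORM corner certificate Z7: target letters p = ![0, 0, h, h, h, 0, 0], q = ![h, 0, 0, 0, h]; 7 terms. -/
theorem kernel_Z7 (h : ℤ) (s t : ℂ) (hD0 : ((h : ℂ) : ℂ) ≠ 0)
    (hz_ms_0 : (-s : ℂ) ≠ 0) (hz_mt_0 : (-t : ℂ) ≠ 0) (hz_ps_1 : (s + 1 : ℂ) ≠ 0) (hz_psh1_1 : (s + (h : ℂ) + 1 : ℂ) ≠ 0) (hz_psh1_0 : (s + (h : ℂ) : ℂ) ≠ 0) (hz_pt_1 : (t + 1 : ℂ) ≠ 0) (hz_pth1_1 : (t + (h : ℂ) + 1 : ℂ) ≠ 0) (hz_pth1_0 : (t + (h : ℂ) : ℂ) ≠ 0) (hz_puh1_1 : (s + t + (h : ℂ) + 1 : ℂ) ≠ 0) :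
    barnesKernel ![0, 0, h, h, h, 0, 0] ![h, 0, 0, 0, h] s t =
        (((1 : ℂ) + (-2 : ℂ) * (h : ℂ) + (1 : ℂ) * (h : ℂ) ^ 2) / (((h : ℂ)) * ((h : ℂ)))) * barnesKernel ![0, 0, h - 1, h - 1, h - 1, 0, 1] ![h - 1, 0, 1, 1, h - 1] s t +
        (((-2 : ℂ) + (2 : ℂ) * (h : ℂ) + (1 : ℂ) * (h : ℂ) ^ 2 + (-1 : ℂ) * (h : ℂ) ^ 3) / (((h : ℂ)) * ((h : ℂ)))) * barnesKernel ![0, 0, h - 1, h, h - 1, 0, 1] ![h, 0, 1, 1, h] s t +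
        (((-1 : ℂ) * (h : ℂ) + (1 : ℂ) * (h : ℂ) ^ 3) / (((h : ℂ)) * ((h : ℂ)))) * barnesKernel ![0, 0, h, h, h - 1, 0, 1] ![h, 0, 1, 1, h] s t +
        (((1 : ℂ) + (-2 : ℂ) * (h : ℂ) + (1 : ℂ) * (h : ℂ) ^ 2) / (((h : ℂ)) * ((h : ℂ)))) * barnesKernel ![0, 1, h - 1, h - 1, h - 1, 0, 0] ![h - 2, 1, 0, 0, h - 1] s t +
        (((2 : ℂ) * (h : ℂ) + (-1 : ℂ) * (h : ℂ) ^ 3) / (((h : ℂ)) * ((h : ℂ)))) * barnesKernel ![0, 1, h - 1, h, h, 0, 0] ![h - 1, 1, 0, 0, h] s t +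
        (((1 : ℂ) + (-1 : ℂ) * (h : ℂ) + (-1 : ℂ) * (h : ℂ) ^ 2 + (1 : ℂ) * (h : ℂ) ^ 3) / (((h : ℂ)) * ((h : ℂ)))) * barnesKernel ![0, 1, h, h, h, 1, 1] ![h - 1, 0, 0, 1, h - 1] s (t - 1) +
        (((-1 : ℂ) + (3 : ℂ) * (h : ℂ) + (-3 : ℂ) * (h : ℂ) ^ 2 + (1 : ℂ) * (h : ℂ) ^ 3) / (((h : ℂ)) * ((h : ℂ)))) * barnesKernel ![1, 1, h, h + 1, h, 1, 1] ![h, 0, 0, 0, h] (s - 1) (t - 1) := by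
  have hG_ms_1 : Complex.Gamma (-s + 1) = (-s) * Complex.Gamma (-s) := by
    have h' := Complex.Gamma_add_one (-s) hz_ms_0
    rw [show (-s : ℂ) + 1 = -s + 1 by ring] at h'
    exact h'
  have hG_mt_1 : Complex.Gamma (-t + 1) = (-t) * Complex.Gamma (-t) := by
    have h' := Complex.Gamma_add_one (-t) hz_mt_0
    rw [show (-t : ℂ) + 1 = -t + 1 by ring] at h'
    exact h'
  have hG_ps_2 : Complex.Gamma (s + 2) = (s + 1) * Complex.Gamma (s + 1) := by
    have h' := Complex.Gamma_add_one (s + 1) hz_ps_1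
    rw [show (s + 1 : ℂ) + 1 = s + 2 by ring] at h'
    exact h'
  have hG_psh1_2 : Complex.Gamma (s + (h : ℂ) + 2) = (s + (h : ℂ) + 1) * Complex.Gamma (s + (h : ℂ) + 1) := by
    have h' := Complex.Gamma_add_one (s + (h : ℂ) + 1) hz_psh1_1
    rw [show (s + (h : ℂ) + 1 : ℂ) + 1 = s + (h : ℂ) + 2 by ring] at h'
    exact h'
  have hG_psh1_1 : Complex.Gamma (s + (h : ℂ) + 1) = (s + (h : ℂ)) * Complex.Gamma (s + (h : ℂ)) := by
    have h' := Complex.Gamma_add_one (s + (h : ℂ)) hz_psh1_0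
    rw [show (s + (h : ℂ) : ℂ) + 1 = s + (h : ℂ) + 1 by ring] at h'
    exact h'
  have hG_pt_2 : Complex.Gamma (t + 2) = (t + 1) * Complex.Gamma (t + 1) := by
    have h' := Complex.Gamma_add_one (t + 1) hz_pt_1
    rw [show (t + 1 : ℂ) + 1 = t + 2 by ring] at h'
    exact h'
  have hG_pth1_2 : Complex.Gamma (t + (h : ℂ) + 2) = (t + (h : ℂ) + 1) * Complex.Gamma (t + (h : ℂ) + 1) := by
    have h' := Complex.Gamma_add_one (t + (h : ℂ) + 1) hz_pth1_1
    rw [show (t + (h : ℂ) + 1 : ℂ) + 1 = t + (h : ℂ) + 2 by ring] at h'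
    exact h'
  have hG_pth1_1 : Complex.Gamma (t + (h : ℂ) + 1) = (t + (h : ℂ)) * Complex.Gamma (t + (h : ℂ)) := by
    have h' := Complex.Gamma_add_one (t + (h : ℂ)) hz_pth1_0
    rw [show (t + (h : ℂ) : ℂ) + 1 = t + (h : ℂ) + 1 by ring] at h'
    exact h'
  have hG_puh1_2 : Complex.Gamma (s + t + (h : ℂ) + 2) = (s + t + (h : ℂ) + 1) * Complex.Gamma (s + t + (h : ℂ) + 1) := by
    have h' := Complex.Gamma_add_one (s + t + (h : ℂ) + 1) hz_puh1_1
    rw [show (s + t + (h : ℂ) + 1 : ℂ) + 1 = s + t + (h : ℂ) + 2 by ring] at h'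
    exact h'
  rw [term_0 h s t, term_1 h s t, term_2 h s t, term_3 h s t, term_4 h s t, term_5 h s t, term_6 h s t, term_7 h s t]
  rw [hG_ms_1, hG_mt_1, hG_ps_2, hG_psh1_2, hG_psh1_1, hG_pt_2, hG_pth1_2, hG_pth1_1, hG_puh1_2]
  by_cases hGd0 : Complex.Gamma (s + (h : ℂ)) = 0
  · simp [hGd0]
  by_cases hGd1 : Complex.Gamma (t + (h : ℂ)) = 0
  · simp [hGd1]
  field_simp
  ring

end Summit.KontsevichZagierPeriods.Zeta5Search.WedgeDictionary.KernelUniform.Z7
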